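import Summits.BirchSwinnertonDyer.BirchSwinnertonDyer.Theorems.ClassRecordThreeIMCDivAtThreeB
import Summits.BirchSwinnertonDyer.BirchSwinnertonDyer.Theorems.SchneiderFreeAdditiveX3LogOmegaConjugatePrime
import Summits.BirchSwinnertonDyer.Rank1Residual.X11b.Three.CharTorsionClasswide
import HarnessLib

/-!
# X11b @ `p = 3`, HALVES@3 — THE T = 0 RE-THREAD OF THE ORIENTATION REPAIR: `Three.StepLAt W` from
# H1 ∧ H2 ∧ H3ᴮ ∧ CTL₀ (`Three.stepLAt_of_halves₃B`), WITHOUT any rank input — the H3 atom read with the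
# Selmer X-slot at the prime OPPOSITE to the frame's (routes `ClassRecordThree` ∕ `KolyvaginRoadThree`,
# items 19494 ∕ 19506 ∕ 19107 ∕ 19155; plan g30 RULING 1 (E), RULING 2 (G4))

Cell `bsd-stepL` (run/shared/lean/pub/bsd-stepL/), seat `bsd-stepL-bdp` (prover g16, 2026-08-27).
`--supports stmt-BirchSwinnertonDyer-19494 --as helper`. Theorems only (no definition, no named fact, no
`sorry`). Companion of `Theorems/ClassRecordThreeIMCDivAtThreeB.lean` (the atom `Three.IMCDivAt₃B`).

## What and why

The @3 kernel consumes H3 in exactly ONE place: `Three.stepLAt_of_halves₃` ∕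
`Three.stepLAt_of_halves₃_of_classX11b` (`X11b/Three/StepLHalves.lean`, `CharTorsionClasswide.lean`), called by
`Theorems/ClassRecordThreeKernelUpper.lean` on roads (b)/(d); everything downstream is `Three.StepLAt W`, which is
PRIME-SYMMETRIC (it concludes `IMCLowerWaldspurgerOnTreeAt 3 κ 𝔭 γ (embAt K 3 𝔭) P` at EVERY degree-one
`𝔭 ∋ 3`). With the oriented atom `Three.IMCDivAt₃B` (frame at `(ι', 𝔭')`, X-slot at `𝔭bar ≠ 𝔭'`) the
assembly `Halves.imcLowerWaldspurgerOnTreeAt_of_value_of_dvd` at X-slot `𝔭` must take its frame — hence its H2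
VALUE — at the OTHER prime `𝔭'`, whose value formula reads `log_{ω_E}` through `embAt K 3 𝔭'`, while
`StepLAt` at `𝔭` wants `embAt K 3 𝔭`. The re-thread (ORIENT-AUDIT Q4 (T0)) is done here WITHOUT the rank-one
input of (T0): `embAt K 3 𝔭 = embAt K 3 𝔭' ∘ σ` for the non-trivial `σ ∈ Gal(K/ℚ)` (door-c5's
`SchneiderFreeAdditiveX3.exists_algEquiv_embAt_eq_comp`), and S0's datum is CLOSED UNDER `σ`: with
`(Dt, H, ι, P)` also `(Dt, H, ι ∘ σ, σ_* P)` is a datum (`(ι∘σ)_*(σ_*P) = ι_*P = heegnerPointComplex Dt H`,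
`σ_*P` non-torsion). Reading H2 at the conjugate datum and `𝔭'` gives the value
`u·((1 − a₃/3)·log_{ω_E}(σ_*P) at 𝔭')²`, and `ord₃ log(σ_*P at embAt 𝔭') = ord₃ log(P at embAt 𝔭' ∘ σ)
= ord₃ log(P at embAt 𝔭)` (`X11b.R1.padicLogOrd_map_eq_comp`) — no `σ_*P = ±P + torsion`, no GZK.

* §1 `exists_ne_degreeOne_prime` — for `[K:ℚ] = 2` and a degree-one `𝔭 ∋ p`, the OTHER prime `𝔭' ≠ 𝔭`
  above `p`, also of degree one (tree `placesOver_trichotomy_of_finrank_eq_two`).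
* §2 `heegnerDatum_map_conj` ∕ `not_isOfFinAddOrder_map` — the datum is closed under `σ`.
* §3 **`Three.stepLAt_of_halves₃B : exists_isNewformOf → CharTorsionAt₃ W → BDPExistsAt₃ W → BDPValueAt₃ W →
  IMCDivAt₃B W → StepLAt W`** and **`Three.stepLAt_of_halves₃_of_classX11bB`** (CTL₀ from the class, as
  `CharTorsionClasswide`) — the twins the kernel's two call sites need (one-token swap in a `…KernelUpperB`).

HONEST FRAMING: implications only; H1 ∕ H2 ∕ H3ᴮ ∕ CTL₀ are hypotheses; nothing is discharged, booked or
re-labelled (T7); O2 stays OPEN; BSD(E,3) is proved for no class. The A-orientation theorems stay in the tree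
as correct implications from the (misstated) A-atom.

References: [Castella2018] Thm. 2.3, Thm. 3.2, §5 (5.1)–(5.3) (arXiv:1704.06608 pp. 5, 9, 12);
[KellerYin2024] Def. 3.4.1 ∕ Thm. 3.5.1; [CastellaGrossiLeeSkinner2022] §2 («`v̄` is induced by `ι_p ∘ c`»);
[FrohlichTaylor1990] III §1 (1.14)(a); cell audit ORIENT-AUDIT-19270 Q4 (a) + (T0).
-/

set_option autoImplicit false
set_option linter.dupNamespace false

noncomputable section

open scoped Classical

namespace Summit.BirchSwinnertonDyer.Rank1Residual.X11b.Three

open WeierstrassCurve NumberField IsDedekindDomain Field PowerSeries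
  Literature.NumberTheory.EllipticCurves Literature.NumberTheory.EllipticCurves.ModularForms
  Literature.NumberTheory.EllipticCurves.Rank1Residual
  Literature.NumberTheory.GaloisRepresentations Literature.NumberTheory.GaloisCohomology
  Summit.BirchSwinnertonDyer.Rank1Residual.X11b.AcSelmer
  Summit.BirchSwinnertonDyer.Rank1Residual.X11b.CongruenceLimit
  Summit.BirchSwinnertonDyer.Rank1Residual.X11b.Halves
  Summit.BirchSwinnertonDyer.BirchSwinnertonDyer.Theorems.SchneiderFreeAdditiveX3

/-! ### §1 The other prime above a split `p` in a quadratic field -/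

/-- **The conjugate prime.** For `[K:ℚ] = 2` and a prime `𝔭 ∋ p` of `𝓞 K` of degree one
(`e(𝔭|p) = f(𝔭|p) = 1`), there is a SECOND prime `𝔭' ≠ 𝔭` above `p`, also of degree one: the
fundamental identity `Σ e f = 2` (tree `placesOver_trichotomy_of_finrank_eq_two`) leaves only the split
case. [cite: NeukirchANT1999, Ch. I (8.2)–(8.3) (fundamental identity), quadratic case] -/
theorem exists_ne_degreeOne_prime {K : Type} [Field K] [NumberField K] (h2 : Module.finrank ℚ K = 2)
    {p : ℕ} [Fact p.Prime] {𝔭 : HeightOneSpectrum (𝓞 K)} (h𝔭 : ((p : ℕ) : 𝓞 K) ∈ 𝔭.asIdeal)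
    (he : 𝔭.asIdeal.ramificationIdx (𝓞 ℚ) = 1) (hf : 𝔭.asIdeal.inertiaDeg (𝓞 ℚ) = 1) :
    ∃ 𝔭' : HeightOneSpectrum (𝓞 K), 𝔭' ≠ 𝔭 ∧ ((p : ℕ) : 𝓞 K) ∈ 𝔭'.asIdeal ∧
      𝔭'.asIdeal.ramificationIdx (𝓞 ℚ) = 1 ∧ 𝔭'.asIdeal.inertiaDeg (𝓞 ℚ) = 1 := by
  have hv : 𝔭.under (𝓞 ℚ) = ratPlace p := under_eq_ratPlace_of_mem h𝔭
  rcases placesOver_trichotomy_of_finrank_eq_two K h2 (ratPlace p) with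
    ⟨w₁, w₂, hne, hset, hef⟩ | ⟨w, hset, -, hf2⟩ | ⟨w, hset, he2, -⟩
  · have hmem : 𝔭 ∈ ({w₁, w₂} : Set (HeightOneSpectrum (𝓞 K))) := by rw [← hset]; exact hv
    have hw₁ : w₁.under (𝓞 ℚ) = ratPlace p := by
      have : w₁ ∈ ({w₁, w₂} : Set (HeightOneSpectrum (𝓞 K))) := Set.mem_insert _ _
      rw [← hset] at this; exact this
    have hw₂ : w₂.under (𝓞 ℚ) = ratPlace p := by
      have : w₂ ∈ ({w₁, w₂} : Set (HeightOneSpectrum (𝓞 K))) := Set.mem_insert_of_mem _ rfl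
      rw [← hset] at this; exact this
    rcases hmem with rfl | rfl
    · exact ⟨w₂, hne.symm, mem_of_under_eq_ratPlace hw₂, hef w₂ hw₂⟩
    · exact ⟨w₁, hne, mem_of_under_eq_ratPlace hw₁, hef w₁ hw₁⟩
  · exfalso
    have hmem : 𝔭 ∈ ({w} : Set (HeightOneSpectrum (𝓞 K))) := by rw [← hset]; exact hv
    rw [Set.mem_singleton_iff] at hmem
    subst hmem
    omega
  · exfalso
    have hmem : 𝔭 ∈ ({w} : Set (HeightOneSpectrum (𝓞 K))) := by rw [← hset]; exact hv
    rw [Set.mem_singleton_iff] at hmem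
    subst hmem
    omega

/-! ### §2 S0's datum is closed under an involution of `K` -/

section Conj

variable {K : Type} [Field K] [NumberField K]

/-- For an involution `σ` of `K` and `ι : K → ℂ`: `(ι ∘ σ)_* (σ_* P) = ι_* P` — the conjugate datum
`(ι ∘ σ, σ_* P)` has the SAME complex image point (Mathlib `Point.map_map`). [folklore] -/
theorem map_comp_map_conj (W : WeierstrassCurve ℚ) (σ : K ≃ₐ[ℚ] K) (hσσ : ∀ x, σ (σ x) = x)
    (ι : K →+* ℂ) (P : (W.baseChange K).toAffine.Point) :
    WeierstrassCurve.Affine.Point.map (ι.comp (σ : K →+* K)).toRatAlgHom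
        (WeierstrassCurve.Affine.Point.map (σ : K →+* K).toRatAlgHom P) =
      WeierstrassCurve.Affine.Point.map ι.toRatAlgHom P := by
  have hfg : ((ι.comp (σ : K →+* K)).toRatAlgHom).comp ((σ : K →+* K).toRatAlgHom) = ι.toRatAlgHom := by
    refine AlgHom.ext fun x => ?_
    change ι (σ (σ x)) = ι x
    rw [hσσ]
  rw [WeierstrassCurve.Affine.Point.map_map (W' := W) ((σ : K →+* K).toRatAlgHom)
    ((ι.comp (σ : K →+* K)).toRatAlgHom) P, hfg]

/-- `σ_* P` is non-torsion when `P` is (the map on points along a field embedding is injective).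
[folklore] -/
theorem not_isOfFinAddOrder_map (W : WeierstrassCurve ℚ) (τ : K →+* K)
    {P : (W.baseChange K).toAffine.Point} (hP : ¬ IsOfFinAddOrder P) :
    ¬ IsOfFinAddOrder (WeierstrassCurve.Affine.Point.map τ.toRatAlgHom P) := by
  rwa [(WeierstrassCurve.Affine.Point.map_injective (W' := W) τ.toRatAlgHom).isOfFinAddOrder_iff]

end Conj

/-! ### §3 `Three.StepLAt W` from H1 ∧ H2 ∧ H3ᴮ ∧ CTL₀ -/

section Halves

variable {W : WeierstrassCurve ℚ} [W.IsElliptic] [W.IsGloballyMinimal]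

/-- **S10 HALVES@3, ORIENTED: `exists_isNewformOf ∧ CTL₀@3 ∧ H1 ∧ H2 ∧ H3ᴮ ⟹ Three.StepLAt W`.** At a
degree-one `𝔭 ∋ 3` (the X-slot wanted by `StepLAt`), take the conjugate prime `𝔭'` (§1) and `σ` with
`embAt K 3 𝔭 = embAt K 3 𝔭' ∘ σ` (`exists_algEquiv_embAt_eq_comp`); H1 at `𝔭'` gives a frame
`(ι', Ω_K, Ω_p, L)` inducing `𝔭'`; H3ᴮ at that frame with `𝔭bar := 𝔭` gives `Ch_Λ(X_ac 𝔭)·R₀ ⊆ (L)`; CTL₀ at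
`𝔭` gives the valuation `n`; H2 at the CONJUGATE datum `(ι ∘ σ, σ_* P)` and `𝔭'` gives
`L(0) = u·((1 − a₃/3)·log_{ω_E}(σ_*P) at embAt 𝔭')²`; `Halves.imcLowerWaldspurgerOnTreeAt_of_value_of_dvd`
assembles `IMCLowerWaldspurgerOnTreeAt 3 κ 𝔭 γ (embAt 𝔭') (σ_* P)`, and `ord₃ log` there equals `ord₃ log` of
`P` at `embAt 𝔭' ∘ σ = embAt 𝔭` (`R1.padicLogOrd_map_eq_comp`). No rank input, no named fact.
[cite: Castella2018, §5 (5.1)–(5.3) (arXiv:1704.06608 p. 12) (assembly shape at p ∣ N; inputs typed, not asserted)]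
[cite: CastellaGrossiLeeSkinner2022, §2 (the prime v̄ induced by ι_p ∘ c; frame at v, Selmer at v̄)] -/
theorem stepLAt_of_halves₃B (hnf : exists_isNewformOf) (hctl : CharTorsionAt₃ W)
    (h1 : BDPExistsAt₃ W) (h2 : BDPValueAt₃ W) (h3 : IMCDivAt₃B W) : StepLAt W := by
  intro N _ K _ _ Dt H ι P hX hsurj hN hK hodd hheeg hL1 hP hc hP0 κ hκ γ _ 𝔭 h𝔭 he hf
  subst hN
  obtain ⟨f, hfW⟩ := hnf W
  -- the conjugate prime and the automorphism relating THE two embeddings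
  obtain ⟨𝔭', hne, h𝔭', he', hf'⟩ := exists_ne_degreeOne_prime hK.finrank_eq_two (p := 3) h𝔭 he hf
  obtain ⟨σ, -, hσσ, hemb⟩ :=
    exists_algEquiv_embAt_eq_comp (p := 3) hK.finrank_eq_two h𝔭' he' hf' h𝔭 he hf hne.symm
  -- `hemb : ∀ x, embAt K 3 𝔭 … x = embAt K 3 𝔭' … (σ x)`
  have hcomp : (embAt K 3 𝔭' h𝔭' he' hf').comp (σ : K →+* K) = embAt K 3 𝔭 h𝔭 he hf :=
    RingHom.ext fun x => (hemb x).symm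
  -- the conjugate datum
  set P' : (W.baseChange K).toAffine.Point :=
    WeierstrassCurve.Affine.Point.map (σ : K →+* K).toRatAlgHom P with hP'def
  have hP' : WeierstrassCurve.Affine.Point.map (ι.comp (σ : K →+* K)).toRatAlgHom P' =
      heegnerPointComplex Dt H := by rw [hP'def, map_comp_map_conj W σ hσσ ι P, hP]
  have hP'0 : ¬ IsOfFinAddOrder P' := not_isOfFinAddOrder_map W (σ : K →+* K) hP0
  -- H1 at `𝔭'` (original datum): the frame
  obtain ⟨ι', hι', ΩK, Ωp, L, hΩK, hL⟩ :=
    h1 _ K Dt H ι P hX hsurj rfl hK hodd hheeg hL1 hP hc hP0 κ hκ γ 𝔭' h𝔭' he' hf' f hfW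
  -- H2 at the CONJUGATE datum and `𝔭'`: the value, with `log` of `σ_* P` at `embAt 𝔭'`
  obtain ⟨u, hu⟩ :=
    h2 _ K Dt H (ι.comp (σ : K →+* K)) P' hX hsurj rfl hK hodd hheeg hL1 hP' hc hP'0 κ hκ γ 𝔭' h𝔭'
      he' hf' f hfW ι' hι' ΩK Ωp L hΩK hL
  -- H3ᴮ at the frame prime `𝔭'` with X-slot `𝔭bar := 𝔭`
  have hdiv := h3 _ K Dt H ι P hX hsurj rfl hK hodd hheeg hL1 hP hc hP0 κ hκ γ 𝔭' h𝔭' he' hf' f hfW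
    ι' hι' ΩK Ωp L hΩK hL 𝔭 h𝔭 hne.symm
  -- CTL₀ at `𝔭`
  obtain ⟨n, hn⟩ := hctl _ K Dt H ι P hX hsurj rfl hK hodd hheeg hL1 hP hc hP0 κ hκ γ 𝔭 h𝔭 he hf
  -- assemble at X-slot `𝔭`, log slot `embAt 𝔭'`, point `σ_* P`
  have key : IMCLowerWaldspurgerOnTreeAt 3 κ 𝔭 γ (embAt K 3 𝔭' h𝔭' he' hf') P' :=
    imcLowerWaldspurgerOnTreeAt_of_value_of_dvd hn hdiv u (W.LFunction 3) hu
  -- move the logarithm back to `embAt 𝔭` and the point back to `P`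
  obtain ⟨m, hm, hle⟩ := key
  refine ⟨m, hm, ?_⟩
  rw [hP'def, R1.padicLogOrd_map_eq_comp, hcomp] at hle
  exact hle

/-- **HALVES ⟹ `StepLAt W` on class X11b, ORIENTED — NO control binder** (CTL₀@3 is a theorem from the
class: `charTorsionAt₃_of_classX11b`, published inputs `hKo`, `hPT`, `hEP`): the twin of
`Three.stepLAt_of_halves₃_of_classX11b` with `h3` over `Three.IMCDivAt₃B`, i.e. the one-token replacement for
the two call sites in `Theorems/ClassRecordThreeKernelUpper.lean` (roads (b)/(d)). CONDITIONAL on every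
binder; nothing booked. [cite: Castella2018, Thm. 2.3 (p. 5), Thm. 3.2 (p. 9), §5 (p. 12)]
[cite: GreenbergLNM1716, §3 Lemma 3.3 (p. 87)] -/
theorem stepLAt_of_halves₃_of_classX11bB (hnf : exists_isNewformOf)
    (hKo : ∀ (N : ℕ) [NeZero N] (W : WeierstrassCurve ℚ) (K : Type) [Field K] [NumberField K],
      kolyvagin N W K)
    (hPT : ∀ (K : Type) [Field K] [NumberField K], poitouTate_sum_localTatePairing_eq_zero K)
    (hEP : ∀ (K : Type) [Field K] [NumberField K] (v : HeightOneSpectrum (𝓞 K)),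
      localEulerPoincareCharacteristic (v.adicCompletion K))
    (hX : ClassX11b W 3) (h1 : BDPExistsAt₃ W) (h2 : BDPValueAt₃ W) (h3 : IMCDivAt₃B W) :
    StepLAt W :=
  stepLAt_of_halves₃B hnf (charTorsionAt₃_of_classX11b hKo hPT hEP hX) h1 h2 h3

end Halves

end Summit.BirchSwinnertonDyer.Rank1Residual.X11b.Three

end
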